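import Summits.Ventures.PercRepro.ProfilePointedCircuitClassesInOutLYM
import Summits.Ventures.PercRepro.ProfileTwoTop

/-!
# PercRepro — THE SPANNING `5`-SETS OF `S ∪ Y` IN A RANK-`4` MATROID, II: THE POINT LABELS AND THE PARALLEL PAIR
(p5, gen 41; `proofs/P5-GM1.md` §60)

`M` has rank `4` and no loops, `S` is a spanning `5`-set and `y ∉ S` a point.  The point labels of `y` are the
`s ∈ S` with `(S − s) + y` spanning, i.e. the points of `S` that are NOT coloops of `T := S + y` (`ρ(T) = 4`,
`#T = 6`).  Removing a coloop drops the rank by one (`rk_sdiff_insert_add_one_le_of_coloop`, submodularity), so three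
coloops of `T` inside `S` leave the two remaining points of `S` together with `y` at rank `≤ 1`: a PARALLEL PAIR
inside `S`.  Hence **(P)**: either `y` has at least three point labels, or `S` contains a parallel pair
(`three_le_card_filter_or_exists_parallel_pair`); and `y` always has at least two (`two_le_card_filter_point`, four
coloops would leave `y` itself at rank `0`).
-/

open scoped Matroid

namespace PercRepro.Cogirth

open Finset ThmH Skew Shadow Profile

variable {α : Type} [DecidableEq α] {M : Matroid α} [M.Finite]

section StarStarB

/-- **Coloop removal**: if `s ∈ T` is a coloop of `T` (`ρ(T − s) + 1 ≤ ρ(T)`) and `s ∉ D`, then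
`ρ(T ∖ (D + s)) + 1 ≤ ρ(T ∖ D)` (submodularity of `T ∖ D` and `T − s`). -/
theorem rk_sdiff_insert_add_one_le_of_coloop {T D : Finset α} {s : α} (hs : s ∈ T) (hsD : s ∉ D)
    (hcol : rk M (T.erase s) + 1 ≤ rk M T) :
    rk M (T \ insert s D) + 1 ≤ rk M (T \ D) := by
  have h := rk_union_add_rk_inter_le (M := M) (T \ D) (T.erase s)
  have hu : (T \ D) ∪ T.erase s = T := by
    ext x
    simp only [mem_union, mem_sdiff, mem_erase]
    constructor
    · rintro (h | h)
      · exact h.1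
      · exact h.2
    · intro hx
      by_cases hxs : x = s
      · subst hxs; exact Or.inl ⟨hx, hsD⟩
      · exact Or.inr ⟨hxs, hx⟩
  have hi : (T \ D) ∩ T.erase s = T \ insert s D := by
    ext x
    simp only [mem_inter, mem_sdiff, mem_erase, mem_insert, not_or]
    constructor
    · rintro ⟨⟨hx, hxD⟩, hxs, _⟩; exact ⟨hx, hxs, hxD⟩
    · rintro ⟨hx, hxs, hxD⟩; exact ⟨⟨hx, hxD⟩, hxs, hx⟩
  rw [hu, hi] at h
  omega

/-- The points of `S` that are coloops of `T := S + y` are those whose point label fails. -/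
theorem rk_erase_insert_add_one_le_of_not_label (hR : rk M (gr M) = 4) {S : Finset α} (hS : S ⊆ gr M)
    (hSsp : rk M S = 4) {y : α} (hy : y ∈ gr M) (hyS : y ∉ S) {s : α} (hsS : s ∈ S)
    (h : ¬ rk M (insert y (S.erase s)) = 4) :
    rk M ((insert y S).erase s) + 1 ≤ rk M (insert y S) := by
  have hys : y ≠ s := fun h' => hyS (h' ▸ hsS)
  have e : (insert y S).erase s = insert y (S.erase s) := erase_insert_of_ne hys
  have h4 : rk M (insert y (S.erase s)) ≤ rk M (gr M) :=
    rk_le_rk_gr (insert_subset hy ((erase_subset s S).trans hS))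
  have hT : rk M S ≤ rk M (insert y S) := rk_mono' (subset_insert y S)
  rw [e]
  omega

/-- **(P)**: for `S` spanning with `#S = 5` in a loopless matroid of rank `4`, and a point `y ∉ S`, either at
least three `s ∈ S` have `(S − s) + y` spanning, or `S` contains a parallel pair (three coloops of `S + y` inside
`S` leave the other two points of `S` and `y` at rank `≤ 1`). -/
theorem three_le_card_filter_or_exists_parallel_pair (hR : rk M (gr M) = 4) {S : Finset α} (hS : S ⊆ gr M)
    (hS5 : S.card = 5) (hSsp : rk M S = 4) {y : α} (hy : y ∈ gr M) (hyS : y ∉ S) :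
    3 ≤ (S.filter (fun s => rk M (insert y (S.erase s)) = 4)).card ∨
      ∃ t ∈ S, ∃ t' ∈ S, t ≠ t' ∧ rk M {t, t'} ≤ 1 := by
  by_contra hcon
  rw [not_or, not_le] at hcon
  obtain ⟨hlt, hnp⟩ := hcon
  have hbad : 3 ≤ (S.filter (fun s => ¬ rk M (insert y (S.erase s)) = 4)).card := by
    have := card_filter_add_card_filter_not (s := S) (fun s => rk M (insert y (S.erase s)) = 4)
    omega
  obtain ⟨D, hDS, hD3⟩ := exists_subset_card_eq hbad
  obtain ⟨a, b, c, hab, hac, hbc, hDabc⟩ := card_eq_three.1 hD3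
  have hmem : ∀ s ∈ D, s ∈ S ∧ rk M ((insert y S).erase s) + 1 ≤ rk M (insert y S) := by
    intro s hs
    have h := mem_filter.1 (hDS hs)
    exact ⟨h.1, rk_erase_insert_add_one_le_of_not_label hR hS hSsp hy hyS h.1 h.2⟩
  have haD : a ∈ D := by rw [hDabc]; exact mem_insert_self a _
  have hbD : b ∈ D := by rw [hDabc]; exact mem_insert_of_mem (mem_insert_self b _)
  have hcD : c ∈ D := by rw [hDabc]; exact mem_insert_of_mem (mem_insert_of_mem (mem_singleton_self c))
  obtain ⟨haS, hacol⟩ := hmem a haD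
  obtain ⟨hbS, hbcol⟩ := hmem b hbD
  obtain ⟨hcS, hccol⟩ := hmem c hcD
  have hTr : rk M (insert y S) = 4 :=
    le_antisymm (hR ▸ rk_le_rk_gr (insert_subset hy hS)) (hSsp ▸ rk_mono' (subset_insert y S))
  have haT : a ∈ insert y S := mem_insert_of_mem haS
  have hbT : b ∈ insert y S := mem_insert_of_mem hbS
  have hcT : c ∈ insert y S := mem_insert_of_mem hcS
  -- remove `a`, then `b`, then `c`
  have h1 : rk M ((insert y S) \ {a}) ≤ 3 := by
    rw [sdiff_singleton_eq_erase]; omega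
  have h2 := rk_sdiff_insert_add_one_le_of_coloop (M := M) (D := {a}) hbT
    (by rw [mem_singleton]; exact hab.symm) hbcol
  have h3 := rk_sdiff_insert_add_one_le_of_coloop (M := M) (D := insert b {a}) hcT
    (by rw [mem_insert, mem_singleton, not_or]; exact ⟨hbc.symm, hac.symm⟩) hccol
  -- the two remaining points of `S`
  have hsub3 : insert c (insert b {a}) ⊆ S := by
    intro x hx
    rw [mem_insert, mem_insert, mem_singleton] at hx
    rcases hx with rfl | rfl | rfl
    · exact hcS
    · exact hbS
    · exact haS
  have hcard3 : (insert c (insert b {a}) : Finset α).card = 3 := by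
    rw [card_insert_of_notMem, card_pair hab.symm]
    rw [mem_insert, mem_singleton, not_or]
    exact ⟨hbc.symm, hac.symm⟩
  have hrest : (S \ insert c (insert b {a})).card = 2 := by
    rw [card_sdiff_of_subset hsub3, hS5, hcard3]
  obtain ⟨t, t', htt', hrest_eq⟩ := card_eq_two.1 hrest
  have htmem : t ∈ S \ insert c (insert b {a}) := by rw [hrest_eq]; exact mem_insert_self t _
  have ht'mem : t' ∈ S \ insert c (insert b {a}) := by
    rw [hrest_eq]; exact mem_insert_of_mem (mem_singleton_self t')
  have hpair : ({t, t'} : Finset α) ⊆ (insert y S) \ insert c (insert b {a}) := by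
    intro x hx
    rw [mem_insert, mem_singleton] at hx
    rw [mem_sdiff]
    rcases hx with rfl | rfl
    · exact ⟨mem_insert_of_mem (mem_sdiff.1 htmem).1, (mem_sdiff.1 htmem).2⟩
    · exact ⟨mem_insert_of_mem (mem_sdiff.1 ht'mem).1, (mem_sdiff.1 ht'mem).2⟩
  have hle := rk_mono' (M := M) hpair
  exact hnp ⟨t, (mem_sdiff.1 htmem).1, t', (mem_sdiff.1 ht'mem).1, htt', by omega⟩

/-- **Every point has at least two point labels**: four coloops of `S + y` inside `S` would leave `y` at rank `0`. -/
theorem two_le_card_filter_point (hR : rk M (gr M) = 4) (hll : ∀ x ∈ gr M, rk M {x} = 1) {S : Finset α}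
    (hS : S ⊆ gr M) (hS5 : S.card = 5) (hSsp : rk M S = 4) {y : α} (hy : y ∈ gr M) (hyS : y ∉ S) :
    2 ≤ (S.filter (fun s => rk M (insert y (S.erase s)) = 4)).card := by
  by_contra hcon
  rw [not_le] at hcon
  have hbad : 4 ≤ (S.filter (fun s => ¬ rk M (insert y (S.erase s)) = 4)).card := by
    have := card_filter_add_card_filter_not (s := S) (fun s => rk M (insert y (S.erase s)) = 4)
    omega
  obtain ⟨D, hDS, hD4⟩ := exists_subset_card_eq hbad
  have hmem : ∀ s ∈ D, s ∈ S ∧ rk M ((insert y S).erase s) + 1 ≤ rk M (insert y S) := by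
    intro s hs
    have h := mem_filter.1 (hDS hs)
    exact ⟨h.1, rk_erase_insert_add_one_le_of_not_label hR hS hSsp hy hyS h.1 h.2⟩
  have hTr : rk M (insert y S) = 4 :=
    le_antisymm (hR ▸ rk_le_rk_gr (insert_subset hy hS)) (hSsp ▸ rk_mono' (subset_insert y S))
  -- peel the four coloops off one at a time: `ρ((S + y) ∖ D') + #D' ≤ 4` for every `D' ⊆ D`
  have key : ∀ D' : Finset α, D' ⊆ D → rk M ((insert y S) \ D') + D'.card ≤ 4 := by
    intro D'
    induction D' using Finset.induction_on with
    | empty =>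
      intro _
      rw [sdiff_empty, card_empty]
      omega
    | insert s D' hsD' ih =>
      intro hsub
      have hsD : s ∈ D := hsub (mem_insert_self s D')
      have hD'D : D' ⊆ D := (subset_insert s D').trans hsub
      have hsT : s ∈ insert y S := mem_insert_of_mem (hmem s hsD).1
      have h := rk_sdiff_insert_add_one_le_of_coloop (M := M) (D := D') hsT hsD' (hmem s hsD).2
      have := ih hD'D
      rw [card_insert_of_notMem hsD']
      omega
  have h4 := key D (Subset.refl D)
  rw [hD4] at h4
  have hyD : y ∉ D := fun h => hyS (mem_filter.1 (hDS h)).1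
  have hyT : ({y} : Finset α) ⊆ (insert y S) \ D := by
    intro x hx
    rw [mem_singleton] at hx
    subst hx
    exact mem_sdiff.2 ⟨mem_insert_self x S, hyD⟩
  have := rk_mono' (M := M) hyT
  have := hll y hy
  omega

end StarStarB

end PercRepro.Cogirth
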